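import Literature.AlgebraicGeometry.HodgeTheory.PicardLefschetzNodalForms
import HarnessLib

/-!
# K1-A input: an explicit UNINODAL ternary form of every degree `p ≥ 3` (route `CyclicUnitaryPowers`,
# item stmt-HodgeConjecture-19544)

Helper file (`--supports stmt-HodgeConjecture-19544`) of the prover seat `hodge-nonav-prover-Ax` (g8), cell
`hodge-nonav`. Sorry-free; axioms standard; no definition, no named fact.

For every `m : ℕ` the ternary form of degree `m + 3`

  `f_m = x₂^{m+1} · x₀ x₁ + x₀^{m+3} + x₁^{m+3}`

has EXACTLY ONE singular point in `ℙ²`, the ordinary double point `e₂ = [0:0:1]` (`IsNodalFormWithNodes f_m ![e₂]`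
of `Literature/AlgebraicGeometry/HodgeTheory/PicardLefschetzNodalForms`): the gradient is
`∂₀ f = x₂^{m+1} x₁ + (m+3) x₀^{m+2}`, `∂₁ f = x₂^{m+1} x₀ + (m+3) x₁^{m+2}`, `∂₂ f = (m+1) x₂^m x₀ x₁`; at a zero `z`
of the gradient with `z₂ = 0` the pure powers force `z₀ = z₁ = 0`; with `z₂ ≠ 0` the third equation gives
`z₀ z₁ = 0` and then the first two give `z₀ = z₁ = 0`, so `z = z₂ • e₂`; the Hessian at `e₂` is the matrix of
`x₀ ↔ x₁` with a zero row and column for `x₂`, of rank `2`.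

This is the concrete polynomial input of the re-cut of the Carlson–Toledo meridian fact (CT99 §6 Proposition for a
degeneration of the branch curve to a ONE-NODAL curve): the centre from which one good meridian of the discriminant of
the universal family of `p`-cyclic covers of the plane is drawn (`CyclicUnitaryPowersPLPackageOfNodalMeridian`).

## References

* [CarlsonToledo1999] J. A. Carlson, D. Toledo, Discriminant complements and kernels of monodromy representations,
  Duke Math. J. 97 (1999), §1 ("a smooth point `c` of the discriminant locus. For these `X_c` has exactly one
  node"), §6 (kdoublept).
* [VoisinHodgeII2003] C. Voisin, Hodge Theory and Complex Algebraic Geometry II, CUP 2003, §2.3.1 (ordinary double points).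
-/

-- `Summit.HodgeConjecture.HodgeConjecture.Theorems` is the mandated namespace (single-problem summit), which
-- `linter.dupNamespace` flags; the lakefile turns the linter off tree-wide, restated here for stand-alone checks.
set_option linter.dupNamespace false

noncomputable section

namespace Summit.HodgeConjecture.HodgeConjecture.Theorems.CyclicUnitaryPowersUninodalTernaryForm

open MvPolynomial Literature.AlgebraicGeometry.Motives Literature.AlgebraicGeometry.HodgeTheory

/-- The witness is homogeneous of degree `m + 3`. [folklore] -/
theorem isHomogeneous_nodalTernaryForm (m : ℕ) : (X 2 ^ (m + 1) * (X 0 * X 1) + X 0 ^ (m + 3) + X 1 ^ (m + 3) : MvPolynomial (Fin 3) ℂ).IsHomogeneous (m + 3) := by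
  have hX : ∀ i : Fin 3, (X i : MvPolynomial (Fin 3) ℂ).IsHomogeneous 1 := fun i => isHomogeneous_X ℂ i
  have hA : (X 2 ^ (m + 1) * (X 0 * X 1) : MvPolynomial (Fin 3) ℂ).IsHomogeneous (m + 3) := by
    have h := ((hX 2).pow (m + 1)).mul ((hX 0).mul (hX 1))
    rwa [show 1 * (m + 1) + (1 + 1) = m + 3 by ring] at h
  have hB : ∀ i : Fin 3, (X i ^ (m + 3) : MvPolynomial (Fin 3) ℂ).IsHomogeneous (m + 3) := fun i => by
    simpa using (hX i).pow (m + 3)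
  exact (hA.add (hB 0)).add (hB 1)

/-- The gradient of the witness (closed form of the three partial derivatives). [folklore] -/
theorem pderiv_nodalTernaryForm (m : ℕ) :
    pderiv 0 (X 2 ^ (m + 1) * (X 0 * X 1) + X 0 ^ (m + 3) + X 1 ^ (m + 3) : MvPolynomial (Fin 3) ℂ) = X 2 ^ (m + 1) * X 1 + C ((m : ℂ) + 3) * X 0 ^ (m + 2) ∧
    pderiv 1 (X 2 ^ (m + 1) * (X 0 * X 1) + X 0 ^ (m + 3) + X 1 ^ (m + 3) : MvPolynomial (Fin 3) ℂ) = X 2 ^ (m + 1) * X 0 + C ((m : ℂ) + 3) * X 1 ^ (m + 2) ∧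
    pderiv 2 (X 2 ^ (m + 1) * (X 0 * X 1) + X 0 ^ (m + 3) + X 1 ^ (m + 3) : MvPolynomial (Fin 3) ℂ) = C ((m : ℂ) + 1) * X 2 ^ m * (X 0 * X 1) := by
  refine ⟨?_, ?_, ?_⟩
  · simp +decide only [map_add, Derivation.leibniz, Derivation.leibniz_pow, pderiv_X,
      Pi.single_apply, smul_eq_mul, mul_zero, add_zero, Nat.add_succ_sub_one, if_true, if_false,
      nsmul_eq_mul, Nat.cast_add, Nat.cast_ofNat]
    simp only [map_natCast, map_ofNat]
    ring
  · simp +decide only [map_add, Derivation.leibniz, Derivation.leibniz_pow, pderiv_X,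
      Pi.single_apply, smul_eq_mul, mul_zero, add_zero, Nat.add_succ_sub_one, if_true, if_false,
      nsmul_eq_mul, Nat.cast_add, Nat.cast_ofNat]
    simp only [map_natCast, map_ofNat]
    ring
  · simp +decide only [map_add, Derivation.leibniz, Derivation.leibniz_pow, pderiv_X,
      Pi.single_apply, smul_eq_mul, mul_zero, add_zero, Nat.add_succ_sub_one, if_true, if_false,
      nsmul_eq_mul, Nat.cast_add, Nat.cast_ofNat]
    simp only [map_natCast, map_one, mul_one]
    ring

/-- The gradient of the witness as a vector of closed forms. [folklore] -/
theorem pderiv_nodalTernaryForm_eq (m : ℕ) (j : Fin 3) :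
    pderiv j (X 2 ^ (m + 1) * (X 0 * X 1) + X 0 ^ (m + 3) + X 1 ^ (m + 3) : MvPolynomial (Fin 3) ℂ) =
      (![X 2 ^ (m + 1) * X 1 + C ((m : ℂ) + 3) * X 0 ^ (m + 2),
          X 2 ^ (m + 1) * X 0 + C ((m : ℂ) + 3) * X 1 ^ (m + 2),
          C ((m : ℂ) + 1) * X 2 ^ m * (X 0 * X 1)] : Fin 3 → MvPolynomial (Fin 3) ℂ) j := by
  obtain ⟨h0, h1, h2⟩ := pderiv_nodalTernaryForm m
  fin_cases j
  exacts [h0, h1, h2]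

/-- The gradient of the witness vanishes at `e₂ = (0,0,1)`. [folklore] -/
theorem eval_pderiv_nodalTernaryForm_e₂ (m : ℕ) (j : Fin 3) :
    eval (![0, 0, 1] : Fin 3 → ℂ) (pderiv j (X 2 ^ (m + 1) * (X 0 * X 1) + X 0 ^ (m + 3) + X 1 ^ (m + 3) : MvPolynomial (Fin 3) ℂ)) = 0 := by
  rw [pderiv_nodalTernaryForm_eq m j]
  fin_cases j <;> simp

/-- **Rank `2` of a `3 × 3` matrix** from a non-zero kernel vector and a two-sided multiple equal to a diagonal
matrix whose diagonal vanishes at exactly one index. [folklore] -/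
theorem rank_eq_two {M A B : Matrix (Fin 3) (Fin 3) ℂ} {v : Fin 3 → ℂ} (hv : v ≠ 0)
    (hMv : M.mulVec v = 0) {w : Fin 3 → ℂ} (hw : A * M * B = Matrix.diagonal w) (k : Fin 3)
    (hk : ∀ i, w i = 0 ↔ i = k) : M.rank = 2 := by
  classical
  apply le_antisymm
  · have h1 := LinearMap.finrank_range_add_finrank_ker M.mulVecLin
    rw [Module.finrank_fintype_fun_eq_card, Fintype.card_fin] at h1
    have hker : 1 ≤ Module.finrank ℂ (LinearMap.ker M.mulVecLin) := by
      rw [Nat.one_le_iff_ne_zero]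
      intro h0
      rw [Submodule.finrank_eq_zero] at h0
      have : v ∈ LinearMap.ker M.mulVecLin := by
        rw [LinearMap.mem_ker, Matrix.mulVecLin_apply, hMv]
      rw [h0, Submodule.mem_bot] at this
      exact hv this
    change Module.finrank ℂ (LinearMap.range M.mulVecLin) ≤ 2
    omega
  · have hcard : Fintype.card {i // w i ≠ 0} = 2 := by
      rw [Fintype.card_subtype]
      have hset : Finset.univ.filter (fun i : Fin 3 ↦ w i ≠ 0) = Finset.univ.erase k := by
        ext i
        simp only [Finset.mem_filter, Finset.mem_univ, true_and, Finset.mem_erase, ne_eq, hk, and_true]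
      rw [hset, Finset.card_erase_of_mem (Finset.mem_univ k), Finset.card_univ, Fintype.card_fin]
    calc 2 = (Matrix.diagonal w).rank := by rw [Matrix.rank_diagonal, hcard]
      _ = (A * M * B).rank := by rw [hw]
      _ ≤ (A * M).rank := Matrix.rank_mul_le_left _ _
      _ ≤ M.rank := Matrix.rank_mul_le_right _ _

/-- The Hessian of the witness at `e₂` has rank `2`. [folklore] -/
theorem rank_hessian_nodalTernaryForm (m : ℕ) :
    (Matrix.of fun i j : Fin 3 => eval (![0, 0, 1] : Fin 3 → ℂ)
      (pderiv i (pderiv j (X 2 ^ (m + 1) * (X 0 * X 1) + X 0 ^ (m + 3) + X 1 ^ (m + 3) : MvPolynomial (Fin 3) ℂ)))).rank = 2 := by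
  have hM : (Matrix.of fun i j : Fin 3 => eval (![0, 0, 1] : Fin 3 → ℂ)
      (pderiv i (pderiv j (X 2 ^ (m + 1) * (X 0 * X 1) + X 0 ^ (m + 3) + X 1 ^ (m + 3) : MvPolynomial (Fin 3) ℂ)))) = !![0, 1, 0; 1, 0, 0; 0, 0, 0] := by
    ext i j
    rw [Matrix.of_apply, pderiv_nodalTernaryForm_eq m j]
    fin_cases i <;> fin_cases j <;> simp [Derivation.leibniz, Derivation.leibniz_pow, pderiv_X]
  rw [hM]
  refine rank_eq_two (v := ![0, 0, 1]) (A := 1) (B := !![0, 1, 0; 1, 0, 0; 0, 0, 0])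
    (w := ![1, 1, 0]) (fun h => by simpa using congr_fun h 2) ?_ ?_ 2 ?_
  · ext i; fin_cases i <;> simp [Matrix.mulVec, dotProduct, Fin.sum_univ_three]
  · ext i j
    fin_cases i <;> fin_cases j <;> simp [Matrix.mul_apply, Fin.sum_univ_three]
  · intro i; fin_cases i <;> simp

/-- `e₂` is an ordinary double point of the witness. [cite: VoisinHodgeII2003, §2.3.1] -/
theorem isOrdinaryDoublePointOf_nodalTernaryForm (m : ℕ) :
    IsOrdinaryDoublePointOf (n := 1) (X 2 ^ (m + 1) * (X 0 * X 1) + X 0 ^ (m + 3) + X 1 ^ (m + 3) : MvPolynomial (Fin 3) ℂ) ![0, 0, 1] :=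
  ⟨fun h => by simpa using congr_fun h 2, eval_pderiv_nodalTernaryForm_e₂ m, rank_hessian_nodalTernaryForm m⟩

/-- A vector `z : Fin 3 → ℂ` is `t • q` as soon as all its coordinates agree with those of `t • q`. [folklore] -/
theorem eq_smul_of_apply_eq {z q : Fin 3 → ℂ} {t : ℂ} (h0 : z 0 = t * q 0) (h1 : z 1 = t * q 1)
    (h2 : z 2 = t * q 2) : z = t • q := by
  funext i
  fin_cases i
  · simpa using h0
  · simpa using h1
  · simpa using h2

/-- **Uniqueness of the singular point of the witness**: a non-zero `z` at which the gradient vanishes is a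
multiple of `e₂`. [folklore] -/
theorem eq_smul_of_grad_nodalTernaryForm (m : ℕ) (z : Fin 3 → ℂ) (hz : z ≠ 0)
    (hgrad : ∀ j, eval z (pderiv j (X 2 ^ (m + 1) * (X 0 * X 1) + X 0 ^ (m + 3) + X 1 ^ (m + 3) : MvPolynomial (Fin 3) ℂ)) = 0) :
    z = z 2 • (![0, 0, 1] : Fin 3 → ℂ) := by
  have hd : ((m : ℂ) + 3) ≠ 0 := by exact_mod_cast Nat.succ_ne_zero (m + 2)
  have hd1 : ((m : ℂ) + 1) ≠ 0 := by exact_mod_cast Nat.succ_ne_zero m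
  have hg : ∀ j, eval z ((![X 2 ^ (m + 1) * X 1 + C ((m : ℂ) + 3) * X 0 ^ (m + 2),
          X 2 ^ (m + 1) * X 0 + C ((m : ℂ) + 3) * X 1 ^ (m + 2),
          C ((m : ℂ) + 1) * X 2 ^ m * (X 0 * X 1)] : Fin 3 → MvPolynomial (Fin 3) ℂ) j) = 0 :=
    fun j => by rw [← pderiv_nodalTernaryForm_eq m j]; exact hgrad j
  have g0 := hg 0
  have g1 := hg 1
  have g2 := hg 2
  simp only [Matrix.cons_val_zero, Matrix.cons_val_one, Matrix.cons_val_two,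
    Matrix.head_cons, Matrix.tail_cons, map_add, map_mul, map_pow, eval_X, eval_C] at g0 g1 g2
  by_cases hz2 : z 2 = 0
  · exfalso
    apply hz
    rw [hz2, zero_pow (Nat.succ_ne_zero _), zero_mul, zero_add] at g0 g1
    have e0 : z 0 = 0 := (pow_eq_zero_iff (Nat.succ_ne_zero _)).1 ((mul_eq_zero.1 g0).resolve_left hd)
    have e1 : z 1 = 0 := (pow_eq_zero_iff (Nat.succ_ne_zero _)).1 ((mul_eq_zero.1 g1).resolve_left hd)
    funext i
    fin_cases i <;> simp [e0, e1, hz2]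
  · have hs : z 0 * z 1 = 0 :=
      (mul_eq_zero.1 g2).resolve_left (mul_ne_zero hd1 (pow_ne_zero _ hz2))
    have hw : z 2 ^ (m + 1) ≠ 0 := pow_ne_zero _ hz2
    rcases mul_eq_zero.1 hs with e0 | e1
    · -- `z₀ = 0`, then `∂₀` gives `z₁ = 0`
      rw [e0, zero_pow (Nat.succ_ne_zero _), mul_zero, add_zero] at g0
      have e1 : z 1 = 0 := (mul_eq_zero.1 g0).resolve_left hw
      exact eq_smul_of_apply_eq (by simp [e0]) (by simp [e1]) (by simp)
    · -- `z₁ = 0`, then `∂₁` gives `z₀ = 0`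
      rw [e1, zero_pow (Nat.succ_ne_zero _), mul_zero, add_zero] at g1
      have e0 : z 0 = 0 := (mul_eq_zero.1 g1).resolve_left hw
      exact eq_smul_of_apply_eq (by simp [e0]) (by simp [e1]) (by simp)

/-- **The witness is nodal with the single node `e₂ = [0:0:1]`.** [cite: VoisinHodgeII2003, §2.3.1] -/
theorem isNodalFormWithNodes_nodalTernaryForm (m : ℕ) :
    IsNodalFormWithNodes (n := 1) (X 2 ^ (m + 1) * (X 0 * X 1) + X 0 ^ (m + 3) + X 1 ^ (m + 3) : MvPolynomial (Fin 3) ℂ) ![(![0, 0, 1] : Fin 3 → ℂ)] := by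
  refine ⟨fun i => ?_, fun i i' _ => Subsingleton.elim i i', fun z hz hgrad => ⟨0, z 2, ?_⟩⟩
  · rw [Matrix.cons_val_fin_one]
    exact isOrdinaryDoublePointOf_nodalTernaryForm m
  · rw [Matrix.cons_val_fin_one]
    exact eq_smul_of_grad_nodalTernaryForm m z hz hgrad

/-- The witness is not the zero polynomial (its `x₀^{m+3}`-coefficient is `1`). [folklore] -/
theorem nodalTernaryForm_ne_zero (m : ℕ) : (X 2 ^ (m + 1) * (X 0 * X 1) + X 0 ^ (m + 3) + X 1 ^ (m + 3) : MvPolynomial (Fin 3) ℂ) ≠ 0 := by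
  intro h
  have hgrad : ∀ j, eval (![1, 0, 0] : Fin 3 → ℂ) (pderiv j (X 2 ^ (m + 1) * (X 0 * X 1) + X 0 ^ (m + 3) + X 1 ^ (m + 3) : MvPolynomial (Fin 3) ℂ)) = 0 := fun j => by
    rw [h, map_zero, map_zero]
  have h1 : (![1, 0, 0] : Fin 3 → ℂ) ≠ 0 := fun h0 => by simpa using congr_fun h0 0
  have := eq_smul_of_grad_nodalTernaryForm m _ h1 hgrad
  simpa using congr_fun this 0

/-- **An explicit uninodal ternary form of every degree `p ≥ 3`**: a non-zero homogeneous `f` of degree `p`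
whose projective curve `V(f) ⊂ ℙ²` has exactly one singular point, an ordinary double point.
[cite: CarlsonToledo1999, §1 and §6 (kdoublept)] -/
theorem exists_uninodal_ternaryForm {p : ℕ} (hp : 3 ≤ p) :
    ∃ (f : MvPolynomial (Fin 3) ℂ) (x : Fin 3 → ℂ), f.IsHomogeneous p ∧ f ≠ 0 ∧
      IsNodalFormWithNodes (n := 1) f ![x] := by
  obtain ⟨m, rfl⟩ := Nat.exists_eq_add_of_le' hp
  exact ⟨_, ![0, 0, 1], isHomogeneous_nodalTernaryForm m, nodalTernaryForm_ne_zero m,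
    isNodalFormWithNodes_nodalTernaryForm m⟩

end Summit.HodgeConjecture.HodgeConjecture.Theorems.CyclicUnitaryPowersUninodalTernaryForm

end
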